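import Summits.BirchSwinnertonDyer.BirchSwinnertonDyer.Theorems.TameQuarticManinParityTprimeHeegnerUpperOfManinUnitIrreducibleRows
import Summits.BirchSwinnertonDyer.BirchSwinnertonDyer.Theorems.RamifiedHeegnerPairLeafRankOneUpperAtThreeMonoCarrier
import Summits.BirchSwinnertonDyer.Rank1Residual.Additive.KodairaDictionaryThree
import Summits.BirchSwinnertonDyer.Rank1Residual.Additive.LocalThreeTorsionIffTamagawaThreeOfIVHolds
import Literature.NumberTheory.EllipticCurves.NeronComponentIndexTypeIIIProofs
import Literature.NumberTheory.EllipticCurves.NeronComponentIndexTypeIIIstarProofs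
import HarnessLib

/-!
# Crux X₄ `TprimeHeegnerUpperOfManinUnit` (stmt-BirchSwinnertonDyer-23738), line `rows_of_manin_unit` (05f83a59) — the CARRIER
# SPLIT of the common open core Σ of the irreducible-image stubs r₁ / r₂: on the (t′) rows `c₃(E) = 2` is a `3`-unit (kernel),
# so on the MONO-MULTIPLICATIVE-CARRIER rows Σ IS the Jetchev divisibility reading S2 (route `RamifiedHeegnerPair`'s item 27492,
# BY NAME); r₁ / r₂ there ⟸ PUB + S2 + KT 19981 (or a twist-unit certificate)

HONEST FRAMING. Theorems only; helper file (`--supports stmt-BirchSwinnertonDyer-23738 --as helper`, leafhand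
`leafhand-bsd-tamequarticmaninpa-3` g0, 2026-08-31); no definition, no named fact, no `sorry`; CONDITIONAL on every displayed input;
no stub is closed by name, no item is closed, BSD is proved for no curve. Third companion of
`TameQuarticManinParityTprimeHeegnerUpperOfManinUnitIrreducibleRows.lean` (p823764) / `…Composition.lean` (p823868): there the two
irreducible-image research stubs were reduced to ONE displayed Σ-input (global `3^{s′}`-divisibility of the derived Heegner points
to depth `ord₃ ∏_ℓ c_ℓ(E)`) + the (t′) rank-zero lower half, Σ being VACUOUS on the Tamagawa-free rows. This file is the (t′) twin of
the Gss2 leaf's `RamifiedHeegnerPairLeafRankOneUpperAtThreeMonoCarrier.lean` (lead bsd-line-rhp-p2 g4): on the rows where ONE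
multiplicative prime `q ∥ N_E` carries the whole `3`-part of `∏_ℓ c_ℓ(E)`, Σ at depth `≤ ord₃ c_q` is VERBATIM the D-audited Jetchev
reading S2 (`RamifiedHeegnerPair.JetchevDivisibilityReadingS2`, stmt-BirchSwinnertonDyer-27492 — Jetchev 2008 Thm. 1.4 in the
irreducible / additive-`p` reading, general `p`, stated with the local binders «`0 ≤ ord_p j`», «`E[p]` irreducible», «`p ∤ c_p`»):

* §1 `not_three_dvd_localTamagawaNumber_three_of_subTprime` — on a (t′) row at `3` the fibre is Kodaira `III` or `III*`
  (`subTprime_three_iff_kodairaSymbolAt_III_or_IIIstar`), whose Tamagawa number is `2` (Tate's algorithm Steps 4 and 9, tree theorems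
  `localTamagawaNumber_eq_two_of_kodairaSymbolAt_eq_III(_star)_holds`, read over `ℤ₃ ⊆ ℚ₃`): `c₃(E) = 2`, so `3 ∤ c₃(E)` — the
  skeleton's «`c₃ = |Φ₃| = 2` is a `3`-unit» in the kernel; `padicValRat_j_nonneg_of_subTprime` — `ord₃ j ≥ 0` (not potentially
  multiplicative). These discharge S2's two local binders at `p = 3` on the (t′) rows.
* §2 `tprime_upper_three_of_irreducible_monoCarrier_of_divisibilityReading_of_lowerRankZero` — ONE (t′) row with `E[3]` irreducible,
  non-CM, `r_an = 1`, a prime `q ∥ N_E` with `ord₃ ∏_ℓ c_ℓ(E) ≤ ord₃ c_q(E)`, every Tamagawa-`3` carrier multiplicative, a datum `Dt`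
  at level `N_E` with `3 ∤ c(Dt)`: PUB + S2 + L0 ⟹ `Typed.MissingUpperBoundAt W 3` (depth `0` free; at positive depth `q ≠ 3` by §1;
  `d_K ∉ {−3,−4}`; the conductor-`1` Kolyvagin–Heegner datum with bottom point `P`, tree theorems).
  (The L0-free twin over a split twist-unit field follows the same way from p823868's
  `upper_three_of_irreducible_of_sigmaAtDatum_of_twistUnit`; not restated here to keep this module outside the TQS theses-cone.)
* §3 `irreducibleRowsOfManinUnit_monoCarrier_of_pub_of_S2_of_tameLowerHalfRankZero` — in the binders of the two registered stubs: on
  the mono-multiplicative-carrier (t′) rows, r₁ / r₂ ⟸ PUB + S2 (27492 BY NAME) + KT 19981 (BY NAME). So the research content Σ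
  of r₁ / r₂ is READING-GRADE on these rows and genuinely open (Jetchev's Conj. 1.3 Σ-form) only on the rows with ≥ 2 Tamagawa-`3`
  carriers or an additive carrier of type `IV`/`IV*`.

References: [cite: Jetchev2008, Thm. 1.4, Cor. 1.5 (p. 812), Rem. 6.2, Thm. 6.3] [cite: MatarNekovar2019, Thm. 0.7 (p. 456) and
§0.11 (p. 457)] [cite: SilvermanATAEC1994, IV.9.4 Steps 4 and 9 (PDF pp. 344–346)] [cite: FriedbergHoffstein1995, Thm. B]
[cite: GrossZagier1986, Thm. I.(6.3) and (7.3)] [cite: Miller2011LMS, Def. 1.1].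
-/

-- D-0017: single-problem summit, so `Summit.BirchSwinnertonDyer.BirchSwinnertonDyer.…` repeats a namespace BY DESIGN.
set_option linter.dupNamespace false
set_option autoImplicit false

noncomputable section

open scoped Classical NumberField
open WeierstrassCurve IsDedekindDomain IsDedekindDomain.HeightOneSpectrum NumberField
  Rat.HeightOneSpectrum Literature Literature.NumberTheory.EllipticCurves
  Literature.NumberTheory.EllipticCurves.ModularForms
  Literature.NumberTheory.EllipticCurves.Rank1Residual
  Literature.NumberTheory.EllipticCurves.Rank1Residual.Typed
  Literature.NumberTheory.EllipticCurves.KrizLi2019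
  Literature.NumberTheory.QuadraticFields
  Summit.BirchSwinnertonDyer.Rank1Residual
  Summit.BirchSwinnertonDyer.Rank1Residual.Additive
  Summit.BirchSwinnertonDyer.Rank1Residual.X11b
  Summit.BirchSwinnertonDyer.Rank1Residual.X11b.Three
  Summit.BirchSwinnertonDyer.BirchSwinnertonDyer.Theses
  Summit.BirchSwinnertonDyer.BirchSwinnertonDyer.Theses.RamifiedHeegnerPair
  Summit.BirchSwinnertonDyer.BirchSwinnertonDyer.Theorems
  Summit.BirchSwinnertonDyer.BirchSwinnertonDyer.Theorems.SchneiderFree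
  Summit.BirchSwinnertonDyer.BirchSwinnertonDyer.Theorems.RamifiedPairUpperBound

namespace Summit.BirchSwinnertonDyer.BirchSwinnertonDyer.Theorems.TprimeHeegnerUpperOfManinUnit

/-! ## §1 (t′) bookkeeping at `3`: Kodaira `III`/`III*`, so `c₃ = 2` and `3 ∤ c₃`; `ord₃ j ≥ 0` -/

/-- **`c₃(E) = 2` on a (t′) row at `3`.** For `W/ℚ` globally minimal, additive at `3` of type (t′), the fibre at `3` is Kodaira
`III` or `III*` (`subTprime_three_iff_kodairaSymbolAt_III_or_IIIstar`) and Tate's algorithm gives `c = 2` in both cases (tree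
theorems `localTamagawaNumber_eq_two_of_kodairaSymbolAt_eq_III_holds`, `…_IIIstar_holds`, read over `ℤ₃ ⊆ ℚ₃` by
`localTamagawaNumber_padic_eq_placeOf`). [cite: SilvermanATAEC1994, IV.9.4 Steps 4 and 9 (PDF pp. 344–346) with Rem. IV.9.3] -/
theorem localTamagawaNumber_three_eq_two_of_subTprime (W : WeierstrassCurve ℚ) [W.IsElliptic] [W.IsGloballyMinimal]
    (hadd : Addv W 3) (hT : SubTprime W 3) : (W.baseChange ℚ_[3]).localTamagawaNumber ℤ_[3] = 2 := by
  haveI : PerfectField (IsLocalRing.ResidueField ((Additive.placeOf 3).adicCompletionIntegers ℚ)) :=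
    PerfectField.ofFinite
  rw [localTamagawaNumber_padic_eq_placeOf W 3]
  rcases (subTprime_three_iff_kodairaSymbolAt_III_or_IIIstar (W := W) hadd).mp hT with h | h
  · exact localTamagawaNumber_eq_two_of_kodairaSymbolAt_eq_III_holds (Additive.placeOf 3) W h
  · exact localTamagawaNumber_eq_two_of_kodairaSymbolAt_eq_IIIstar_holds (Additive.placeOf 3) W h

/-- **`3 ∤ c₃(E)` on a (t′) row at `3`** (`c₃ = 2`): the one displayed local binder «`p ∤ c_p`» of the Jetchev reading S2 is
discharged on the (t′) rows. [cite: SilvermanATAEC1994, IV.9.4 Steps 4 and 9 (PDF pp. 344–346)] -/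
theorem not_three_dvd_localTamagawaNumber_three_of_subTprime (W : WeierstrassCurve ℚ) [W.IsElliptic] [W.IsGloballyMinimal]
    (hadd : Addv W 3) (hT : SubTprime W 3) : ¬ 3 ∣ (W.baseChange ℚ_[3]).localTamagawaNumber ℤ_[3] := by
  rw [localTamagawaNumber_three_eq_two_of_subTprime W hadd hT]
  decide

/-- **`ord₃ j(E) ≥ 0` on a (t′) row** (not potentially multiplicative, the first conjunct of `SubTprime`). [folklore] -/
theorem padicValRat_j_nonneg_of_subTprime (W : WeierstrassCurve ℚ) [W.IsElliptic] [W.IsGloballyMinimal]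
    (hT : SubTprime W 3) : 0 ≤ padicValRat 3 W.j :=
  not_lt.mp hT.1

/-! ## §2 One datum on a mono-multiplicative-carrier (t′) row: Σ at the datum IS the Jetchev reading S2 -/

/-- **The upper half AT `W` ON A MONO-MULTIPLICATIVE-CARRIER (t′) ROW WITH A MANIN-CLEAN DATUM, from S2 and L0.** Data: `W/ℚ`
globally minimal, non-CM, additive of type (t′) at `3` with `E[3]` IRREDUCIBLE, `r_an(W) = 1`; a prime `q ∥ N_E` carrying the
whole `3`-part of the Tamagawa product (`ord₃ ∏_ℓ c_ℓ(E) ≤ ord₃ c_q(E)`); the reading's global binder (`htam`: every `q′ ∣ N_E`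
with `3 ∣ c_{q′}(E)` is multiplicative); a parametrisation datum `Dt` at level `N_E` with `3 ∤ c(Dt)`. DISPLAYED INPUT `hD` = S2 =
`RamifiedHeegnerPair.JetchevDivisibilityReadingS2` (stmt-BirchSwinnertonDyer-27492) BY NAME; `hL0` = the non-CM (t′) rank-ZERO
lower half at `3`. NAMED FACTS `hGZ hKo hGZK hmod hGZ73 hMN hnf hFH`. OUTPUT: `Typed.MissingUpperBoundAt W 3`. Proof = the Gss2
twin (lead rhp-p2's `leafRankOneUpper_three_monoCarrier_of_divisibilityReading_of_lowerRankZero`) over p823764's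
`tprime_upper_three_of_irreducible_of_sigmaAtDatum_of_lowerRankZero`: depth `0` free; at positive depth `3 ∣ c_q` so `q ≠ 3`
(§1); `ord₃ j ≥ 0` (§1); `d_K ∉ {−3, −4}`; the conductor-`1` Kolyvagin–Heegner datum with bottom point `P` (Darmon 3.6 /
Shimura reciprocity, tree theorems). CONDITIONAL; nothing asserted about any curve.
[cite: Jetchev2008, Thm. 1.4 and Cor. 1.5 (p. 812), Rem. 6.2, Thm. 6.3] [cite: MatarNekovar2019, Thm. 0.7 (p. 456) and §0.11 (p. 457)]
[cite: FriedbergHoffstein1995, Thm. B] [cite: GrossZagier1986, Thm. I.(6.3) and (7.3)] [cite: Miller2011LMS, Def. 1.1] -/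
theorem tprime_upper_three_of_irreducible_monoCarrier_of_divisibilityReading_of_lowerRankZero
    (hGZ : ∀ (N : ℕ) [NeZero N] (W : WeierstrassCurve ℚ) (K : Type) [Field K] [NumberField K],
      gross_zagier N W K)
    (hKo : ∀ (N : ℕ) [NeZero N] (W : WeierstrassCurve ℚ) (K : Type) [Field K] [NumberField K],
      kolyvagin N W K)
    (hGZK : rank_eq_analyticRank_of_analyticRank_le_one) (hmod : hasEntireLFunction_rat)
    (hGZ73 : GrossZagier1986_thm_I_7_3)
    (hMN : MatarNekovar2019.thm07_padicValNat_card_sha_primary_add_le_of_globalDivisibility_of_irreducible)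
    (hnf : exists_isNewformOf) (hFH : friedbergHoffstein_exists_heegnerField_splitDivisors_twist_ne_zero)
    (hD : JetchevDivisibilityReadingS2)
    (hL0 : ∀ (V : WeierstrassCurve ℚ) [V.IsElliptic] [V.IsGloballyMinimal],
      ¬ V.HasCM → Addv V 3 → SubTprime V 3 → V.analyticRank = 0 → MissingLowerBoundAt V 3)
    (W : WeierstrassCurve ℚ) [W.IsElliptic] [W.IsGloballyMinimal] [NeZero (W.conductorNorm ℤ)]
    (hCM : ¬ W.HasCM) (hadd : Addv W 3) (hT : SubTprime W 3) (hirr : W.HasIrreducibleModPGaloisRep 3)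
    (hr : W.analyticRank = 1)
    (q : ℕ) [Fact q.Prime] (hqN : q ∣ W.conductorNorm ℤ) (hq2 : ¬ q ^ 2 ∣ W.conductorNorm ℤ)
    (hmono : padicValNat 3 W.tamagawaProduct ≤ padicValNat 3 ((W.baseChange ℚ_[q]).localTamagawaNumber ℤ_[q]))
    (htam : ∀ (q' : ℕ) [Fact q'.Prime], q' ∣ W.conductorNorm ℤ →
      3 ∣ (W.baseChange ℚ_[q']).localTamagawaNumber ℤ_[q'] → ¬ q' ^ 2 ∣ W.conductorNorm ℤ)
    (Dt : ModularParametrizationData W (W.conductorNorm ℤ)) (hc : ¬ (3 : ℤ) ∣ Dt.c) :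
    MissingUpperBoundAt W 3 := by
  -- the (t′) row discharges the reading's local binders at `p = 3`
  have hj : 0 ≤ padicValRat 3 W.j := padicValRat_j_nonneg_of_subTprime W hT
  have hc3 : ¬ 3 ∣ (W.baseChange ℚ_[3]).localTamagawaNumber ℤ_[3] :=
    not_three_dvd_localTamagawaNumber_three_of_subTprime W hadd hT
  have h3N : 3 ∣ W.conductorNorm ℤ :=
    (W.dvd_conductorNorm_iff_not_hasGoodReductionAtPrime 3).mpr (not_good_of_addv W 3 hadd)
  have hc0 : padicValNat 3 Dt.c.natAbs = 0 :=
    padicValNat.eq_zero_of_not_dvd fun h ↦ hc (Int.ofNat_dvd_left.mpr h)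
  refine tprime_upper_three_of_irreducible_of_sigmaAtDatum_of_lowerRankZero hGZ hKo hGZK hmod hGZ73 hMN hnf hFH hL0
    W hCM hadd hT hirr hr Dt ?_
  intro K _ _ H ι P hK hHN hLt hP hnt hodd s' hs' n d hn hℓ
  -- depth `0` is free
  rcases Nat.eq_zero_or_pos s' with hs0 | hspos
  · subst hs0
    exact koly_pDiv_zero d 3
  -- positive depth: `3 ∣ c_q`, so the carrier `q` is not `3`
  have hsq : s' ≤ padicValNat 3 ((W.baseChange ℚ_[q]).localTamagawaNumber ℤ_[q]) := by omega
  have hq3 : q ≠ 3 := by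
    rintro rfl
    have hpos : 0 < padicValNat 3 ((W.baseChange ℚ_[3]).localTamagawaNumber ℤ_[3]) := by omega
    exact hc3 (dvd_of_one_le_padicValNat hpos)
  -- `d_K ∉ {-3, -4}`: `3 ∣ N_E` splits in `K`, `d_K` odd
  have h3 : NumberField.discr K ≠ -3 := by
    intro h
    exact (X11b.Three.not_dvd_discr_and_not_dvd_torsionOrder_of_heegner hK hHN (by decide) h3N).1
      (h ▸ ⟨-1, by norm_num⟩)
  have h4 : NumberField.discr K ≠ -4 := by
    intro h
    rw [h] at hodd
    exact (Int.not_odd_iff_even.mpr ⟨-2, by norm_num⟩) hodd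
  -- the conductor-`1` Kolyvagin–Heegner datum on the frame, with bottom point `P` (Darmon 3.6 / Shimura, proved)
  obtain ⟨d₁⟩ := exists_kolyvaginHeegnerData_one
    (phi_heegnerTau_mem_singularModuliField_holds (W.conductorNorm ℤ) W K) hK Dt H.β ι H.dvd_sq_sub
  have hPd : d₁.toGeomPoints d₁.derivedPoint = toGeomPoints (W.baseChange K) P :=
    X11b.KolyvaginBottom.toGeomPoints_derivedPoint_one_eq
      (heegnerPointOfConductor_one_galoisConj_holds (W.conductorNorm ℤ) W K) hK hHN hP d₁ rfl
  have hy₁ : ¬ IsOfFinAddOrder d₁.derivedPoint := by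
    intro hfin
    apply hnt
    have h1 : IsOfFinAddOrder (d₁.toGeomPoints d₁.derivedPoint) := d₁.toGeomPoints.isOfFinAddOrder hfin
    rw [hPd] at h1
    exact (toGeomPoints_injective (W.baseChange K)).isOfFinAddOrder_iff.mp h1
  -- S2 at `p = 3`, carrier `q`, depth `s'`
  exact hD W hCM K hK h3 h4 hHN 3 (by decide) hadd hj hirr hc3 htam Dt H.β ι d₁ hy₁ q hqN hq2 hq3 s' hsq n d hn hℓ

/-! ## §3 In the binders of the two registered irreducible-image stubs: the mono-multiplicative-carrier rows ⟸ PUB + S2 + 19981 -/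

/-- **r₁ / r₂ of `rows_of_manin_unit` ON THE MONO-MULTIPLICATIVE-CARRIER (t′) ROWS from PUB + S2 + KT 19981, by name.** For every
non-CM (t′) rank-one `W` with `E[3]` irreducible (r₁: `ρ̄_{E,3}` onto implies it; r₂ carries it) such that (ROW) some prime
`q ∥ N_E` carries the whole `3`-part of `∏_ℓ c_ℓ(E)` and every Tamagawa-`3` carrier is multiplicative, and every datum `D` at level
`N_E` with `3 ∤ c(D)` (the stub's Manin unit): `Typed.MissingUpperBoundAt W 3` follows from the printed named facts, route
`RamifiedHeegnerPair`'s item `JetchevDivisibilityReadingS2` (27492, BY NAME) and route KT's item `TameLowerHalfRankZero` (19981, BY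
NAME). On these rows the common open core Σ of the two research stubs is READING-GRADE (Jetchev 2008 Thm. 1.4, audited irreducible
reading); the Tamagawa-free rows (p823764) are the sub-case `ord₃ c_q = 0`. CONDITIONAL; closes nothing.
[cite: Jetchev2008, Thm. 1.4 and Cor. 1.5 (p. 812)] [cite: MatarNekovar2019, Thm. 0.7 (p. 456) and §0.11 (p. 457)]
[cite: FriedbergHoffstein1995, Thm. B] [cite: Miller2011LMS, Def. 1.1] -/
theorem irreducibleRowsOfManinUnit_monoCarrier_of_pub_of_S2_of_tameLowerHalfRankZero
    (hGZ : ∀ (N : ℕ) [NeZero N] (W : WeierstrassCurve ℚ) (K : Type) [Field K] [NumberField K],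
      gross_zagier N W K)
    (hKo : ∀ (N : ℕ) [NeZero N] (W : WeierstrassCurve ℚ) (K : Type) [Field K] [NumberField K],
      kolyvagin N W K)
    (hGZK : rank_eq_analyticRank_of_analyticRank_le_one) (hGZ73 : GrossZagier1986_thm_I_7_3)
    (hMN : MatarNekovar2019.thm07_padicValNat_card_sha_primary_add_le_of_globalDivisibility_of_irreducible)
    (hnf : exists_isNewformOf) (hFH : friedbergHoffstein_exists_heegnerField_splitDivisors_twist_ne_zero)
    (hD : JetchevDivisibilityReadingS2) (hKT : KatoDescentTamePotSupersingular.TameLowerHalfRankZero) :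
    ∀ (W : WeierstrassCurve ℚ) [W.IsElliptic] [W.IsGloballyMinimal] [NeZero (W.conductorNorm ℤ)],
      ¬ W.HasCM → Rank1Residual.Addv W 3 → Summit.BirchSwinnertonDyer.Rank1Residual.Additive.SubTprime W 3 →
      W.HasIrreducibleModPGaloisRep 3 → W.analyticRank = 1 →
      (∃ (q : ℕ) (_ : Fact q.Prime), q ∣ W.conductorNorm ℤ ∧ ¬ q ^ 2 ∣ W.conductorNorm ℤ ∧
        padicValNat 3 W.tamagawaProduct ≤ padicValNat 3 ((W.baseChange ℚ_[q]).localTamagawaNumber ℤ_[q])) →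
      (∀ (q' : ℕ) [Fact q'.Prime], q' ∣ W.conductorNorm ℤ →
        3 ∣ (W.baseChange ℚ_[q']).localTamagawaNumber ℤ_[q'] → ¬ q' ^ 2 ∣ W.conductorNorm ℤ) →
      ∀ (D : ModularParametrizationData W (W.conductorNorm ℤ)), ¬ (3 : ℤ) ∣ D.maninConstant →
        Rank1Residual.Typed.MissingUpperBoundAt W 3 := by
  intro W _ _ _ hCM hadd hT hirr hr hrow htam D hc
  obtain ⟨q, hq, hqN, hq2, hmono⟩ := hrow
  exact tprime_upper_three_of_irreducible_monoCarrier_of_divisibilityReading_of_lowerRankZero hGZ hKo hGZK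
    (hasEntireLFunction_rat_of_exists_isNewformOf hnf) hGZ73 hMN hnf hFH hD
    (tprimeLowerRankZero_three_of_tameLowerHalfRankZero hKT) W hCM hadd hT hirr hr q hqN hq2 hmono htam D hc

end Summit.BirchSwinnertonDyer.BirchSwinnertonDyer.Theorems.TprimeHeegnerUpperOfManinUnit

end
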